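import Summits.Ventures.PercRepro.S1PlaneCounts

/-!
# PercRepro — S1 LEMMA A, THE NULLITY BUDGET OF TWO RANK-`4` FLATS (p2, gen 16; SUBCLAIM-S1 §4 (A12))

Nullity `ν(X) = |X| − r(X)` is supermodular (`r` is submodular, `|·|` is modular): for two distinct rank-`4` flats
`F ≠ F'` of a matroid whose lines have `≤ 3` and whose planes have `≤ 6` points, the intersection `F ∩ F'` is a flat
of rank `≤ 3` (a rank-`4` subflat of `F` is `F` itself), so `|F ∩ F'| ≤ r(F ∩ F') + 3`, and with `ν(F ∪ F') ≤ d`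
(nullity is monotone: `r(E) ≤ r(S) + |E ∖ S|`):

    |F| + |F'| = |F ∪ F'| + |F ∩ F'| ≤ (r(F ∪ F') + d) + (r(F ∩ F') + 3) ≤ 8 + d + 3.

* `encard_le_eRk_add_of_nullity` — nullity is monotone under restriction (`|S| ≤ r(S) + d` when `|E| = r(E) + d`);
* `eRk_inter_le_three_of_flats_ne` — two distinct rank-`4` flats meet in a set of rank `≤ 3`;
* `ncard_le_eRk_add_three_of_eRk_le_three` — a set of rank `≤ 3` has at most `r + 3` points (lines `≤ 3`, planes `≤ 6`);
* **`ncard_add_ncard_le_of_flats_ne`** — LEMMA A: `|F| + |F'| ≤ d + 11`;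
* **`eq_of_nine_le_ncard_of_flats`** — at `d ≤ 6` there is at most ONE rank-`4` flat with `≥ 9` points;
* **`eq_of_ten_le_ncard_of_flats`** — at `d ≤ 7` there is at most ONE rank-`4` flat with `10` points.
Axioms: standard.
-/

open scoped Matroid

namespace PercRepro

namespace S1

open Set

variable {α : Type}

/-- **Nullity is monotone**: if `|E| = r(E) + d` then every `S ⊆ E` has `|S| ≤ r(S) + d`
(`r(E) ≤ r(S) + |E ∖ S|`). -/
theorem encard_le_eRk_add_of_nullity (M : Matroid α) [M.Finite] {S : Set α} (hS : S ⊆ M.E) {d : ℕ}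
    (hd : M.E.encard = M.eRank + d) : S.encard ≤ M.eRk S + d := by
  have h1 : M.eRank ≤ M.eRk S + (M.E \ S).encard := by
    rw [← M.eRk_ground]
    calc M.eRk M.E = M.eRk (S ∪ (M.E \ S)) := by rw [union_sdiff_cancel hS]
      _ ≤ M.eRk S + (M.E \ S).encard := M.eRk_union_le_eRk_add_encard S (M.E \ S)
  have h2 : S.encard + (M.E \ S).encard = M.E.encard := by
    rw [add_comm]; exact Set.encard_sdiff_add_encard_of_subset hS
  have hfin : (M.E \ S).encard ≠ ⊤ := (M.ground_finite.subset sdiff_subset).encard_lt_top.ne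
  have h3 : S.encard + (M.E \ S).encard ≤ (M.eRk S + d) + (M.E \ S).encard := by
    rw [h2, hd]
    calc M.eRank + d ≤ (M.eRk S + (M.E \ S).encard) + d := by gcongr
      _ = (M.eRk S + d) + (M.E \ S).encard := by ring
  exact (WithTop.add_le_add_iff_right hfin).1 h3

/-- The `ℕ`-form: `|S| ≤ r(S) + d` with `r(S) = (rS : ℕ)`. -/
theorem ncard_le_add_of_nullity (M : Matroid α) [M.Finite] {S : Set α} (hS : S ⊆ M.E) {d rS : ℕ}
    (hd : M.E.encard = M.eRank + d) (hr : M.eRk S = (rS : ℕ∞)) : S.ncard ≤ rS + d := by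
  have h := encard_le_eRk_add_of_nullity M hS hd
  rw [hr, ← (M.ground_finite.subset hS).cast_ncard_eq] at h
  exact_mod_cast h

/-- **Two distinct rank-`4` flats meet in a set of rank `≤ 3`**: a subset of `F` of rank `≥ 4 = r(F)` spans `F`. -/
theorem eRk_inter_le_three_of_flats_ne (M : Matroid α) [M.Finite] {F F' : Set α} (hF : F ⊆ M.E)
    (hclF : M.closure F = F) (hrF : M.eRk F = 4) (hclF' : M.closure F' = F') (hrF' : M.eRk F' = 4)
    (hne : F ≠ F') : M.eRk (F ∩ F') ≤ 3 := by
  by_contra h4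
  push Not at h4
  have hfin : (F ∩ F').Finite := M.ground_finite.subset (inter_subset_left.trans hF)
  have h4' : (4 : ℕ∞) ≤ M.eRk (F ∩ F') := by
    have : (3 : ℕ∞) + 1 ≤ M.eRk (F ∩ F') := Order.add_one_le_of_lt h4
    rwa [show ((3 : ℕ∞) + 1) = 4 by norm_num] at this
  have h1 : M.closure (F ∩ F') = M.closure F :=
    closure_eq_closure_of_subset_of_eRk_le M hfin inter_subset_left (by rw [hrF]; exact h4')
  have h2 : M.closure (F ∩ F') = M.closure F' :=
    closure_eq_closure_of_subset_of_eRk_le M hfin inter_subset_right (by rw [hrF']; exact h4')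
  exact hne (by rw [← hclF, ← h1, h2, hclF'])

/-- **A set of rank `≤ 3` has at most `r + 3` points** (lines `≤ 3`, planes `≤ 6`). -/
theorem ncard_le_eRk_add_three_of_eRk_le_three (M : Matroid α) [M.Finite]
    (hline : ∀ L ⊆ M.E, M.eRk L ≤ 2 → L.ncard ≤ 3) (hplane : ∀ P ⊆ M.E, M.eRk P ≤ 3 → P.ncard ≤ 6)
    {X : Set α} (hX : X ⊆ M.E) {rX : ℕ} (hr : M.eRk X = (rX : ℕ∞)) (h3 : rX ≤ 3) :
    X.ncard ≤ rX + 3 := by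
  rcases Nat.lt_or_ge rX 3 with hlt | hge
  · have h2 : M.eRk X ≤ 2 := by rw [hr]; exact_mod_cast Nat.lt_succ_iff.1 hlt
    have := hline X hX h2
    omega
  · have hr3 : rX = 3 := le_antisymm h3 hge
    have h3' : M.eRk X ≤ 3 := by rw [hr, hr3]; exact_mod_cast le_rfl
    have := hplane X hX h3'
    omega

/-- **LEMMA A — THE NULLITY BUDGET**: two distinct rank-`4` flats of the core of corank `d` satisfy
`|F| + |F'| ≤ d + 11`. -/
theorem ncard_add_ncard_le_of_flats_ne (M : Matroid α) [M.Finite]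
    (hline : ∀ L ⊆ M.E, M.eRk L ≤ 2 → L.ncard ≤ 3) (hplane : ∀ P ⊆ M.E, M.eRk P ≤ 3 → P.ncard ≤ 6)
    {d : ℕ} (hd : M.E.encard = M.eRank + d) {F F' : Set α} (hF : F ⊆ M.E) (hclF : M.closure F = F)
    (hrF : M.eRk F = 4) (hF' : F' ⊆ M.E) (hclF' : M.closure F' = F') (hrF' : M.eRk F' = 4)
    (hne : F ≠ F') : F.ncard + F'.ncard ≤ d + 11 := by
  have hFfin : F.Finite := M.ground_finite.subset hF
  have hF'fin : F'.Finite := M.ground_finite.subset hF'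
  have hXE : F ∩ F' ⊆ M.E := inter_subset_left.trans hF
  have hUE : F ∪ F' ⊆ M.E := union_subset hF hF'
  -- the two ranks as naturals
  have hXne : M.eRk (F ∩ F') ≠ ⊤ :=
    ne_top_of_le_ne_top (hFfin.subset inter_subset_left).encard_lt_top.ne (M.eRk_le_encard _)
  obtain ⟨rX, hrX⟩ := ENat.ne_top_iff_exists.1 hXne
  have hUne : M.eRk (F ∪ F') ≠ ⊤ :=
    ne_top_of_le_ne_top (hFfin.union hF'fin).encard_lt_top.ne (M.eRk_le_encard _)
  obtain ⟨rU, hrU⟩ := ENat.ne_top_iff_exists.1 hUne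
  -- `r(F ∩ F') ≤ 3`
  have hX3 : rX ≤ 3 := by
    have := eRk_inter_le_three_of_flats_ne M hF hclF hrF hclF' hrF' hne
    rw [← hrX] at this
    exact_mod_cast this
  -- submodularity: `r(F ∩ F') + r(F ∪ F') ≤ 8`
  have hsub : rX + rU ≤ 8 := by
    have := M.eRk_inter_add_eRk_union_le F F'
    rw [← hrX, ← hrU, hrF, hrF'] at this
    exact_mod_cast this
  -- the counts
  have hXcard : (F ∩ F').ncard ≤ rX + 3 :=
    ncard_le_eRk_add_three_of_eRk_le_three M hline hplane hXE hrX.symm hX3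
  have hUcard : (F ∪ F').ncard ≤ rU + d := ncard_le_add_of_nullity M hUE hd hrU.symm
  have hmod := Set.ncard_union_add_ncard_inter F F' hFfin hF'fin
  omega

/-- **At corank `d ≤ 6` there is at most one rank-`4` flat with `≥ 9` points** (`9 + 9 > d + 11`). -/
theorem eq_of_nine_le_ncard_of_flats (M : Matroid α) [M.Finite]
    (hline : ∀ L ⊆ M.E, M.eRk L ≤ 2 → L.ncard ≤ 3) (hplane : ∀ P ⊆ M.E, M.eRk P ≤ 3 → P.ncard ≤ 6)
    {d : ℕ} (hd : M.E.encard = M.eRank + d) (hd6 : d ≤ 6) {F F' : Set α} (hF : F ⊆ M.E)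
    (hclF : M.closure F = F) (hrF : M.eRk F = 4) (hF' : F' ⊆ M.E) (hclF' : M.closure F' = F')
    (hrF' : M.eRk F' = 4) (h9 : 9 ≤ F.ncard) (h9' : 9 ≤ F'.ncard) : F = F' := by
  by_contra hne
  have := ncard_add_ncard_le_of_flats_ne M hline hplane hd hF hclF hrF hF' hclF' hrF' hne
  omega

/-- **At corank `d ≤ 7` there is at most one rank-`4` flat with `10` points** (`10 + 10 > d + 11`). -/
theorem eq_of_ten_le_ncard_of_flats (M : Matroid α) [M.Finite]
    (hline : ∀ L ⊆ M.E, M.eRk L ≤ 2 → L.ncard ≤ 3) (hplane : ∀ P ⊆ M.E, M.eRk P ≤ 3 → P.ncard ≤ 6)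
    {d : ℕ} (hd : M.E.encard = M.eRank + d) (hd7 : d ≤ 7) {F F' : Set α} (hF : F ⊆ M.E)
    (hclF : M.closure F = F) (hrF : M.eRk F = 4) (hF' : F' ⊆ M.E) (hclF' : M.closure F' = F')
    (hrF' : M.eRk F' = 4) (h10 : 10 ≤ F.ncard) (h10' : 10 ≤ F'.ncard) : F = F' := by
  by_contra hne
  have := ncard_add_ncard_le_of_flats_ne M hline hplane hd hF hclF hrF hF' hclF' hrF' hne
  omega

end S1

end PercRepro
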